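import Literature.NumberTheory.EllipticCurves.ModularCurveEtaQuotientsProofs
import Literature.NumberTheory.EllipticCurves.CuspFormLFunction
import HarnessLib


/-!
# η-parity: even coefficients of half-antiperiodic cusp forms vanish (desc g46; landed by LEAD p1 g25 from
`HOME/desc/g46/EtaParity-desc-g46.lean` sha16 cb48212f81bebb4c, T-desc-59)

`a₂ₖ(φ) = 0` for a cusp form with `φ(τ + ½) = −φ(τ)`, and the half-shift law of `η`-quotients supported on EVEN `δ`.
Discharges the `heven` input (I2) of the squeeze-transport capstones (`Theorems.ManinLocalTwoThreeTwistDefect*`)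
SIGN-FREE for the root forms `P − Q`, `P + Q` (level 56), `φ₇₂` (level 72) and the level-128 root `128a`
(`cuspCoeff_eq_zero_fiftySixA`, `cuspCoeff_eq_zero_fiftySixB`, `cuspCoeff_eq_zero_seventyTwo`,
`cuspCoeff_eq_zero_oneTwentyEightA`).  Fact-free.
-/

set_option autoImplicit false

set_option linter.dupNamespace false

noncomputable section

open UpperHalfPlane hiding I
open ModularForm Complex Filter CongruenceSubgroup
open scoped MatrixGroups Real ModularForm CongruenceSubgroup Topology Manifold

namespace Summit.BirchSwinnertonDyer.BirchSwinnertonDyer.Theorems.ManinLocalTwoThree.EtaParity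

open Literature.NumberTheory.EllipticCurves.ModularForms

/-! ## §A  Even coefficients of a half-antiperiodic cusp form vanish -/

/-- `𝕢₁(½ + τ) = −𝕢₁(τ)`. [folklore] -/
theorem qParam_one_half_vadd (τ : ℍ) :
    Function.Periodic.qParam 1 (((1 / 2 : ℝ) +ᵥ τ : ℍ) : ℂ) = - Function.Periodic.qParam 1 (τ : ℂ) := by
  simp only [Function.Periodic.qParam, UpperHalfPlane.coe_vadd, Complex.ofReal_one, div_one]
  push_cast
  rw [mul_add, Complex.exp_add, show (2 * (π : ℂ) * I * (1 / 2) : ℂ) = π * I by ring, Complex.exp_pi_mul_I,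
    neg_one_mul]

/-- **Even `q`-coefficients vanish for a half-antiperiodic cusp form**: if `1` is a strict period of `Γ` and
`f(½ + τ) = −f(τ)` on `ℍ`, then `a₂ₖ(f) = 0` (uniqueness of `q`-expansions, Mathlib
`ModularFormClass.qExpansion_coeff_unique`, applied to `f(τ) = −f(τ+½) = ∑ −(−1)ᵐ aₘ qᵐ`). [folklore] -/
theorem cuspCoeff_eq_zero_of_half_vadd {Γ : Subgroup (GL (Fin 2) ℝ)} {k : ℤ}
    (hΓ : (1 : ℝ) ∈ Γ.strictPeriods) (f : CuspForm Γ k)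
    (h : ∀ τ : ℍ, f ((1 / 2 : ℝ) +ᵥ τ) = - f τ) (n : ℕ) (hn : 2 ∣ n) : cuspCoeff f n = 0 := by
  haveI : Fact (IsCusp OnePoint.infty Γ) := ⟨Γ.isCusp_of_mem_strictPeriods one_pos hΓ⟩
  have hsum := fun τ ↦ UpperHalfPlane.hasSum_qExpansion one_pos
    (SlashInvariantFormClass.periodic_comp_ofComplex f hΓ) (ModularFormClass.holo f)
    (ModularFormClass.bdd_at_infty f) τ
  have hf' : ∀ τ : ℍ, HasSum (fun m ↦ (-((-1) ^ m * (qExpansion 1 ⇑f).coeff m)) •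
      Function.Periodic.qParam 1 (τ : ℂ) ^ m) (f τ) := by
    intro τ
    have h1 := (hsum ((1 / 2 : ℝ) +ᵥ τ)).neg
    rw [h τ, neg_neg] at h1
    have h2 : (fun m ↦ (-((-1) ^ m * (qExpansion 1 ⇑f).coeff m)) • Function.Periodic.qParam 1 (τ : ℂ) ^ m) =
        fun m ↦ -((qExpansion 1 ⇑f).coeff m • Function.Periodic.qParam 1 (((1 / 2 : ℝ) +ᵥ τ : ℍ) : ℂ) ^ m) := by
      funext m
      rw [qParam_one_half_vadd, neg_pow]
      simp only [smul_eq_mul]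
      ring
    rw [h2]
    exact h1
  have huniq : -((-1) ^ n * (qExpansion 1 ⇑f).coeff n) = (qExpansion 1 ⇑f).coeff n :=
    ModularFormClass.qExpansion_coeff_unique one_pos hΓ hf' n
  obtain ⟨j, rfl⟩ := hn
  rw [pow_mul, neg_one_sq, one_pow, one_mul] at huniq
  unfold cuspCoeff
  exact add_self_eq_zero.mp (by linear_combination -huniq)

/-- The `Γ₀(N)` case (`1` is the strict width of `∞`, Mathlib `strictWidthInfty_Gamma0`). [folklore] -/
theorem cuspCoeff_eq_zero_of_half_vadd_gamma0 {N : ℕ} {k : ℤ} (f : CuspForm (Gamma0 N) k)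
    (h : ∀ τ : ℍ, f ((1 / 2 : ℝ) +ᵥ τ) = - f τ) (n : ℕ) (hn : 2 ∣ n) : cuspCoeff f n = 0 :=
  cuspCoeff_eq_zero_of_half_vadd (strictWidthInfty_Gamma0 N ▸ Subgroup.strictWidthInfty_mem_strictPeriods _) f h n hn

/-! ## §B  Half-shift law of `η`-quotients with even support -/

/-- `η(δ(½ + z)) = e^{2πi(δ/2)/24} η(δz)` for even `δ`. [folklore] -/
theorem eta_natMul_half_add_of_two_dvd {δ : ℕ} (hδ : 2 ∣ δ) (z : ℂ) :
    η (δ * (1 / 2 + z)) = cexp (2 * π * I * (δ / 2 : ℕ) / 24) * η (δ * z) := by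
  obtain ⟨e, rfl⟩ := hδ
  rw [show ((2 * e : ℕ) : ℂ) * (1 / 2 + z) = (2 * e : ℕ) * z + ((e : ℤ) : ℂ) by push_cast; ring,
    eta_add_intCast, Nat.mul_div_cancel_left e two_pos]
  norm_cast

/-- **Half-shift law**: if `r_δ = 0` for every odd `δ ∣ N`, then
`∏ η(δ(τ+½))^{r_δ} = e^{2πi Σ (δ/2) r_δ / 24} ∏ η(δτ)^{r_δ}`. [folklore] -/
theorem etaQuotient_half_vadd (N : ℕ) (r : ℕ → ℤ) (hr : ∀ δ ∈ N.divisors, ¬ 2 ∣ δ → r δ = 0) (τ : ℍ) :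
    etaQuotient N r ((1 / 2 : ℝ) +ᵥ τ) =
      cexp (2 * π * I * (∑ δ ∈ N.divisors, ((δ / 2 : ℕ) : ℤ) * r δ : ℤ) / 24) * etaQuotient N r τ := by
  rw [etaQuotient_apply, etaQuotient_apply, UpperHalfPlane.coe_vadd]
  have h12 : ((1 / 2 : ℝ) : ℂ) = 1 / 2 := by push_cast; ring
  rw [h12]
  have hfac : ∀ δ ∈ N.divisors, η (δ * (1 / 2 + (τ : ℂ))) ^ r δ =
      cexp (2 * π * I * (δ / 2 : ℕ) / 24) ^ r δ * η (δ * (τ : ℂ)) ^ r δ := by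
    intro δ hδ
    by_cases h2 : 2 ∣ δ
    · rw [eta_natMul_half_add_of_two_dvd h2, mul_zpow]
    · rw [hr δ hδ h2, zpow_zero, zpow_zero, zpow_zero, mul_one]
  rw [Finset.prod_congr rfl hfac, Finset.prod_mul_distrib]
  congr 1
  rw [show (2 * π * I * ((∑ δ ∈ N.divisors, ((δ / 2 : ℕ) : ℤ) * r δ : ℤ) : ℂ) / 24 : ℂ) =
      ∑ δ ∈ N.divisors, (r δ : ℂ) * (2 * π * I * (δ / 2 : ℕ) / 24) by
    simp only [Int.cast_sum, Int.cast_mul, Int.cast_natCast]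
    rw [Finset.mul_sum, Finset.sum_div]
    exact Finset.sum_congr rfl fun δ _ ↦ by ring, Complex.exp_sum]
  refine Finset.prod_congr rfl fun δ _ ↦ ?_
  rw [← Complex.exp_int_mul]

/-- `e^{2πi·12/24} = −1`. -/
theorem cexp_twelve : cexp (2 * π * I * ((12 : ℤ) : ℂ) / 24) = -1 := by
  rw [show (2 * π * I * ((12 : ℤ) : ℂ) / 24 : ℂ) = π * I by push_cast; ring, Complex.exp_pi_mul_I]

/-- `e^{2πi·36/24} = −1`. -/
theorem cexp_thirtySix : cexp (2 * π * I * ((36 : ℤ) : ℂ) / 24) = -1 := by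
  rw [show (2 * π * I * ((36 : ℤ) : ℂ) / 24 : ℂ) = π * I + (1 : ℤ) * (2 * π * I) by push_cast; ring,
    Complex.exp_add, Complex.exp_pi_mul_I, Complex.exp_int_mul_two_pi_mul_I, mul_one]

/-! ## §C  The root forms at 56 and 72 are half-antiperiodic ⟹ their even coefficients vanish -/

/-- The half-shift exponent `Σ_δ (δ/2)·r_δ` of this `η`-quotient (kernel arithmetic). -/
theorem sum_half_P56 : (∑ δ ∈ (56 : ℕ).divisors, ((δ / 2 : ℕ) : ℤ) * expFn [(2, -1), (4, 3), (14, 3), (28, -1)] δ) = 12 := by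
  decide

/-- The half-shift exponent `Σ_δ (δ/2)·r_δ` of this `η`-quotient (kernel arithmetic). -/
theorem sum_half_Q56 : (∑ δ ∈ (56 : ℕ).divisors, ((δ / 2 : ℕ) : ℤ) * expFn [(2, 3), (4, -1), (14, -1), (28, 3)] δ) = 36 := by
  decide

/-- The half-shift exponent `Σ_δ (δ/2)·r_δ` of this `η`-quotient (kernel arithmetic). -/
theorem sum_half_H72a : (∑ δ ∈ (72 : ℕ).divisors, ((δ / 2 : ℕ) : ℤ) * expFn [(2, -2), (4, 4), (6, 2)] δ) = 12 := by
  decide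

/-- The half-shift exponent `Σ_δ (δ/2)·r_δ` of this `η`-quotient (kernel arithmetic). -/
theorem sum_half_H72b : (∑ δ ∈ (72 : ℕ).divisors, ((δ / 2 : ℕ) : ℤ) * expFn [(2, 4), (4, -2), (12, 2)] δ) = 12 := by
  decide

/-- This `η`-quotient is supported on even `δ` (kernel check). -/
theorem support_even_P56 : ∀ δ ∈ (56 : ℕ).divisors, ¬ 2 ∣ δ → expFn [(2, -1), (4, 3), (14, 3), (28, -1)] δ = 0 := by
  decide

/-- This `η`-quotient is supported on even `δ` (kernel check). -/
theorem support_even_Q56 : ∀ δ ∈ (56 : ℕ).divisors, ¬ 2 ∣ δ → expFn [(2, 3), (4, -1), (14, -1), (28, 3)] δ = 0 := by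
  decide

/-- This `η`-quotient is supported on even `δ` (kernel check). -/
theorem support_even_H72a : ∀ δ ∈ (72 : ℕ).divisors, ¬ 2 ∣ δ → expFn [(2, -2), (4, 4), (6, 2)] δ = 0 := by
  decide

/-- This `η`-quotient is supported on even `δ` (kernel check). -/
theorem support_even_H72b : ∀ δ ∈ (72 : ℕ).divisors, ¬ 2 ∣ δ → expFn [(2, 4), (4, -2), (12, 2)] δ = 0 := by
  decide

/-- Half-shift law `φ(τ + ½) = −φ(τ)` for this `η`-quotient. -/
theorem etaQuotient_P56_half_vadd (τ : ℍ) :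
    etaQuotient 56 (expFn [(2, -1), (4, 3), (14, 3), (28, -1)]) ((1 / 2 : ℝ) +ᵥ τ) =
      - etaQuotient 56 (expFn [(2, -1), (4, 3), (14, 3), (28, -1)]) τ := by
  rw [etaQuotient_half_vadd 56 _ support_even_P56 τ, sum_half_P56, cexp_twelve, neg_one_mul]

/-- Half-shift law `φ(τ + ½) = −φ(τ)` for this `η`-quotient. -/
theorem etaQuotient_Q56_half_vadd (τ : ℍ) :
    etaQuotient 56 (expFn [(2, 3), (4, -1), (14, -1), (28, 3)]) ((1 / 2 : ℝ) +ᵥ τ) =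
      - etaQuotient 56 (expFn [(2, 3), (4, -1), (14, -1), (28, 3)]) τ := by
  rw [etaQuotient_half_vadd 56 _ support_even_Q56 τ, sum_half_Q56, cexp_thirtySix, neg_one_mul]

/-- Half-shift law `φ(τ + ½) = −φ(τ)` for this `η`-quotient. -/
theorem etaQuotient_H72a_half_vadd (τ : ℍ) :
    etaQuotient 72 (expFn [(2, -2), (4, 4), (6, 2)]) ((1 / 2 : ℝ) +ᵥ τ) =
      - etaQuotient 72 (expFn [(2, -2), (4, 4), (6, 2)]) τ := by
  rw [etaQuotient_half_vadd 72 _ support_even_H72a τ, sum_half_H72a, cexp_twelve, neg_one_mul]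

/-- Half-shift law `φ(τ + ½) = −φ(τ)` for this `η`-quotient. -/
theorem etaQuotient_H72b_half_vadd (τ : ℍ) :
    etaQuotient 72 (expFn [(2, 4), (4, -2), (12, 2)]) ((1 / 2 : ℝ) +ᵥ τ) =
      - etaQuotient 72 (expFn [(2, 4), (4, -2), (12, 2)]) τ := by
  rw [etaQuotient_half_vadd 72 _ support_even_H72b τ, sum_half_H72b, cexp_twelve, neg_one_mul]

/-- **(I2) for 56a: `a₂ₖ(P − Q) = 0`** for every `φ ∈ S₂(Γ₀(56))` with `⇑φ = P − Q` pointwise. [folklore] -/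
theorem cuspCoeff_eq_zero_fiftySixA (φ : CuspForm (Gamma0 56) 2)
    (hφ : ⇑φ = fun τ ↦ etaQuotient 56 (expFn [(2, -1), (4, 3), (14, 3), (28, -1)]) τ
        - etaQuotient 56 (expFn [(2, 3), (4, -1), (14, -1), (28, 3)]) τ)
    (n : ℕ) (hn : 2 ∣ n) : cuspCoeff φ n = 0 := by
  have hφ' : ∀ σ : ℍ, φ σ = etaQuotient 56 (expFn [(2, -1), (4, 3), (14, 3), (28, -1)]) σ
      - etaQuotient 56 (expFn [(2, 3), (4, -1), (14, -1), (28, 3)]) σ := fun σ ↦ congrFun hφ σ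
  refine cuspCoeff_eq_zero_of_half_vadd_gamma0 φ (fun τ ↦ ?_) n hn
  rw [hφ', hφ', etaQuotient_P56_half_vadd, etaQuotient_Q56_half_vadd]
  ring

/-- **(I2) for 56b: `a₂ₖ(P + Q) = 0`.** [folklore] -/
theorem cuspCoeff_eq_zero_fiftySixB (ψ : CuspForm (Gamma0 56) 2)
    (hψ : ⇑ψ = fun τ ↦ etaQuotient 56 (expFn [(2, -1), (4, 3), (14, 3), (28, -1)]) τ
        + etaQuotient 56 (expFn [(2, 3), (4, -1), (14, -1), (28, 3)]) τ)
    (n : ℕ) (hn : 2 ∣ n) : cuspCoeff ψ n = 0 := by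
  have hψ' : ∀ σ : ℍ, ψ σ = etaQuotient 56 (expFn [(2, -1), (4, 3), (14, 3), (28, -1)]) σ
      + etaQuotient 56 (expFn [(2, 3), (4, -1), (14, -1), (28, 3)]) σ := fun σ ↦ congrFun hψ σ
  refine cuspCoeff_eq_zero_of_half_vadd_gamma0 ψ (fun τ ↦ ?_) n hn
  rw [hψ', hψ', etaQuotient_P56_half_vadd, etaQuotient_Q56_half_vadd]
  ring

/-- **(I2) for 72a: `a₂ₖ(φ₇₂) = 0`.** [folklore] -/
theorem cuspCoeff_eq_zero_seventyTwo (φ : CuspForm (Gamma0 72) 2)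
    (hφ : ⇑φ = fun τ ↦ (2 / 3 : ℂ) * etaQuotient 72 (expFn [(2, -2), (4, 4), (6, 2)]) τ
        + (1 / 3 : ℂ) * etaQuotient 72 (expFn [(2, 4), (4, -2), (12, 2)]) τ)
    (n : ℕ) (hn : 2 ∣ n) : cuspCoeff φ n = 0 := by
  have hφ' : ∀ σ : ℍ, φ σ = (2 / 3 : ℂ) * etaQuotient 72 (expFn [(2, -2), (4, 4), (6, 2)]) σ
      + (1 / 3 : ℂ) * etaQuotient 72 (expFn [(2, 4), (4, -2), (12, 2)]) σ := fun σ ↦ congrFun hφ σ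
  refine cuspCoeff_eq_zero_of_half_vadd_gamma0 φ (fun τ ↦ ?_) n hn
  rw [hφ', hφ', etaQuotient_H72a_half_vadd, etaQuotient_H72b_half_vadd]
  ring


/-! ## §C′  The root form `φ₁₂₈ₐ` (six even-supported `η`-quotients) is half-antiperiodic ⟹ `a₂ₖ(φ₁₂₈ₐ) = 0` -/

/-- `e^{2πi m/24} = −1` for `m = 12 + 24k`. -/
theorem cexp_eq_neg_one_of_eq (m k : ℤ) (h : m = 12 + 24 * k) : cexp (2 * π * I * (m : ℂ) / 24) = -1 := by
  rw [h, show (2 * π * I * ((12 + 24 * k : ℤ) : ℂ) / 24 : ℂ) = π * I + k * (2 * π * I) by push_cast; ring,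
    Complex.exp_add, Complex.exp_pi_mul_I, Complex.exp_int_mul_two_pi_mul_I, mul_one]

/-- This `η`-quotient is supported on even `δ` (kernel check). -/
theorem support_even_128_T1 : ∀ δ ∈ (128 : ℕ).divisors, ¬ 2 ∣ δ → expFn [(8, 1), (16, 1), (32, -1), (64, 1), (128, 2)] δ = 0 := by
  decide

/-- The half-shift exponent `Σ_δ (δ/2)·r_δ` of this `η`-quotient (kernel arithmetic). -/
theorem sum_half_128_T1 : (∑ δ ∈ (128 : ℕ).divisors, ((δ / 2 : ℕ) : ℤ) * expFn [(8, 1), (16, 1), (32, -1), (64, 1), (128, 2)] δ) = 156 := by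
  decide

/-- Half-shift law `φ(τ + ½) = −φ(τ)` for this `η`-quotient. -/
theorem etaQuotient_128_T1_half_vadd (τ : ℍ) :
    etaQuotient 128 (expFn [(8, 1), (16, 1), (32, -1), (64, 1), (128, 2)]) ((1 / 2 : ℝ) +ᵥ τ) = - etaQuotient 128 (expFn [(8, 1), (16, 1), (32, -1), (64, 1), (128, 2)]) τ := by
  rw [etaQuotient_half_vadd 128 _ support_even_128_T1 τ, sum_half_128_T1,
    cexp_eq_neg_one_of_eq 156 6 (by norm_num), neg_one_mul]

/-- This `η`-quotient is supported on even `δ` (kernel check). -/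
theorem support_even_128_T2 : ∀ δ ∈ (128 : ℕ).divisors, ¬ 2 ∣ δ → expFn [(8, 1), (16, 1), (32, -3), (64, 7), (128, -2)] δ = 0 := by
  decide

/-- The half-shift exponent `Σ_δ (δ/2)·r_δ` of this `η`-quotient (kernel arithmetic). -/
theorem sum_half_128_T2 : (∑ δ ∈ (128 : ℕ).divisors, ((δ / 2 : ℕ) : ℤ) * expFn [(8, 1), (16, 1), (32, -3), (64, 7), (128, -2)] δ) = 60 := by
  decide

/-- Half-shift law `φ(τ + ½) = −φ(τ)` for this `η`-quotient. -/
theorem etaQuotient_128_T2_half_vadd (τ : ℍ) :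
    etaQuotient 128 (expFn [(8, 1), (16, 1), (32, -3), (64, 7), (128, -2)]) ((1 / 2 : ℝ) +ᵥ τ) = - etaQuotient 128 (expFn [(8, 1), (16, 1), (32, -3), (64, 7), (128, -2)]) τ := by
  rw [etaQuotient_half_vadd 128 _ support_even_128_T2 τ, sum_half_128_T2,
    cexp_eq_neg_one_of_eq 60 2 (by norm_num), neg_one_mul]

/-- This `η`-quotient is supported on even `δ` (kernel check). -/
theorem support_even_128_T3 : ∀ δ ∈ (128 : ℕ).divisors, ¬ 2 ∣ δ → expFn [(8, 1), (32, 1), (64, 2)] δ = 0 := by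
  decide

/-- The half-shift exponent `Σ_δ (δ/2)·r_δ` of this `η`-quotient (kernel arithmetic). -/
theorem sum_half_128_T3 : (∑ δ ∈ (128 : ℕ).divisors, ((δ / 2 : ℕ) : ℤ) * expFn [(8, 1), (32, 1), (64, 2)] δ) = 84 := by
  decide

/-- Half-shift law `φ(τ + ½) = −φ(τ)` for this `η`-quotient. -/
theorem etaQuotient_128_T3_half_vadd (τ : ℍ) :
    etaQuotient 128 (expFn [(8, 1), (32, 1), (64, 2)]) ((1 / 2 : ℝ) +ᵥ τ) = - etaQuotient 128 (expFn [(8, 1), (32, 1), (64, 2)]) τ := by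
  rw [etaQuotient_half_vadd 128 _ support_even_128_T3 τ, sum_half_128_T3,
    cexp_eq_neg_one_of_eq 84 3 (by norm_num), neg_one_mul]

/-- This `η`-quotient is supported on even `δ` (kernel check). -/
theorem support_even_128_T4 : ∀ δ ∈ (128 : ℕ).divisors, ¬ 2 ∣ δ → expFn [(8, 1), (16, -1), (32, 5), (64, -3), (128, 2)] δ = 0 := by
  decide

/-- The half-shift exponent `Σ_δ (δ/2)·r_δ` of this `η`-quotient (kernel arithmetic). -/
theorem sum_half_128_T4 : (∑ δ ∈ (128 : ℕ).divisors, ((δ / 2 : ℕ) : ℤ) * expFn [(8, 1), (16, -1), (32, 5), (64, -3), (128, 2)] δ) = 108 := by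
  decide

/-- Half-shift law `φ(τ + ½) = −φ(τ)` for this `η`-quotient. -/
theorem etaQuotient_128_T4_half_vadd (τ : ℍ) :
    etaQuotient 128 (expFn [(8, 1), (16, -1), (32, 5), (64, -3), (128, 2)]) ((1 / 2 : ℝ) +ᵥ τ) = - etaQuotient 128 (expFn [(8, 1), (16, -1), (32, 5), (64, -3), (128, 2)]) τ := by
  rw [etaQuotient_half_vadd 128 _ support_even_128_T4 τ, sum_half_128_T4,
    cexp_eq_neg_one_of_eq 108 4 (by norm_num), neg_one_mul]

/-- This `η`-quotient is supported on even `δ` (kernel check). -/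
theorem support_even_128_T5 : ∀ δ ∈ (128 : ℕ).divisors, ¬ 2 ∣ δ → expFn [(8, 1), (16, -1), (32, 3), (64, 3), (128, -2)] δ = 0 := by
  decide

/-- The half-shift exponent `Σ_δ (δ/2)·r_δ` of this `η`-quotient (kernel arithmetic). -/
theorem sum_half_128_T5 : (∑ δ ∈ (128 : ℕ).divisors, ((δ / 2 : ℕ) : ℤ) * expFn [(8, 1), (16, -1), (32, 3), (64, 3), (128, -2)] δ) = 12 := by
  decide

/-- Half-shift law `φ(τ + ½) = −φ(τ)` for this `η`-quotient. -/
theorem etaQuotient_128_T5_half_vadd (τ : ℍ) :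
    etaQuotient 128 (expFn [(8, 1), (16, -1), (32, 3), (64, 3), (128, -2)]) ((1 / 2 : ℝ) +ᵥ τ) = - etaQuotient 128 (expFn [(8, 1), (16, -1), (32, 3), (64, 3), (128, -2)]) τ := by
  rw [etaQuotient_half_vadd 128 _ support_even_128_T5 τ, sum_half_128_T5,
    cexp_eq_neg_one_of_eq 12 0 (by norm_num), neg_one_mul]

/-- This `η`-quotient is supported on even `δ` (kernel check). -/
theorem support_even_128_T6 : ∀ δ ∈ (128 : ℕ).divisors, ¬ 2 ∣ δ → expFn [(8, 1), (16, -2), (32, 7), (64, -2)] δ = 0 := by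
  decide

/-- The half-shift exponent `Σ_δ (δ/2)·r_δ` of this `η`-quotient (kernel arithmetic). -/
theorem sum_half_128_T6 : (∑ δ ∈ (128 : ℕ).divisors, ((δ / 2 : ℕ) : ℤ) * expFn [(8, 1), (16, -2), (32, 7), (64, -2)] δ) = 36 := by
  decide

/-- Half-shift law `φ(τ + ½) = −φ(τ)` for this `η`-quotient. -/
theorem etaQuotient_128_T6_half_vadd (τ : ℍ) :
    etaQuotient 128 (expFn [(8, 1), (16, -2), (32, 7), (64, -2)]) ((1 / 2 : ℝ) +ᵥ τ) = - etaQuotient 128 (expFn [(8, 1), (16, -2), (32, 7), (64, -2)]) τ := by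
  rw [etaQuotient_half_vadd 128 _ support_even_128_T6 τ, sum_half_128_T6,
    cexp_eq_neg_one_of_eq 36 1 (by norm_num), neg_one_mul]

/-- **(I2) for 128a: `a₂ₖ(φ₁₂₈ₐ) = 0`** for every `φ ∈ S₂(Γ₀(128))` with `⇑φ = φ₁₂₈ₐ` pointwise (p3's six-term
`η`-expression, `EtaIdentitiesOneTwentyEightA.periodLatticeLe_oneTwentyEight`). [folklore] -/
theorem cuspCoeff_eq_zero_oneTwentyEightA (φ : CuspForm (Gamma0 128) 2)
    (hφ : ⇑φ = fun σ ↦ (-(4 * etaQuotient 128 (expFn [(8, 1), (16, 1), (32, -1), (64, 1), (128, 2)]) σ)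
        - 2 * etaQuotient 128 (expFn [(8, 1), (16, 1), (32, -3), (64, 7), (128, -2)]) σ
        - 4 * etaQuotient 128 (expFn [(8, 1), (32, 1), (64, 2)]) σ
        + 2 * etaQuotient 128 (expFn [(8, 1), (16, -1), (32, 5), (64, -3), (128, 2)]) σ
        + etaQuotient 128 (expFn [(8, 1), (16, -1), (32, 3), (64, 3), (128, -2)]) σ
        - 2 * etaQuotient 128 (expFn [(8, 1), (16, -2), (32, 7), (64, -2)]) σ))
    (n : ℕ) (hn : 2 ∣ n) : cuspCoeff φ n = 0 := by
  have hφ' : ∀ σ : ℍ, φ σ = (-(4 * etaQuotient 128 (expFn [(8, 1), (16, 1), (32, -1), (64, 1), (128, 2)]) σ)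
        - 2 * etaQuotient 128 (expFn [(8, 1), (16, 1), (32, -3), (64, 7), (128, -2)]) σ
        - 4 * etaQuotient 128 (expFn [(8, 1), (32, 1), (64, 2)]) σ
        + 2 * etaQuotient 128 (expFn [(8, 1), (16, -1), (32, 5), (64, -3), (128, 2)]) σ
        + etaQuotient 128 (expFn [(8, 1), (16, -1), (32, 3), (64, 3), (128, -2)]) σ
        - 2 * etaQuotient 128 (expFn [(8, 1), (16, -2), (32, 7), (64, -2)]) σ) := fun σ ↦ congrFun hφ σ
  refine cuspCoeff_eq_zero_of_half_vadd_gamma0 φ (fun τ ↦ ?_) n hn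
  rw [hφ', hφ', etaQuotient_128_T1_half_vadd, etaQuotient_128_T2_half_vadd, etaQuotient_128_T3_half_vadd,
    etaQuotient_128_T4_half_vadd, etaQuotient_128_T5_half_vadd, etaQuotient_128_T6_half_vadd]
  ring

end Summit.BirchSwinnertonDyer.BirchSwinnertonDyer.Theorems.ManinLocalTwoThree.EtaParity

#harness_tags Summit.BirchSwinnertonDyer.BirchSwinnertonDyer.Theorems.ManinLocalTwoThree.EtaParity.cuspCoeff_eq_zero_oneTwentyEightA

end
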